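import Literature.AlgebraicGeometry.Resolution.ExceptionalHostCharts
import Literature.AlgebraicGeometry.Motives.VarietiesProjectiveSpaceProofs
import Literature.AlgebraicGeometry.Motives.VarietiesGeometricallyIntegralProofs
import Literature.AlgebraicGeometry.Motives.GeometricallyIntegralAlgClosed
import Mathlib.AlgebraicGeometry.Morphisms.Smooth
import Mathlib.AlgebraicGeometry.Morphisms.Flat
import Mathlib.RingTheory.RingHom.Flat
import HarnessLib

/-!
# Exceptional hosts are smooth `ℙ¹`-fibrations: flatness, smoothness, irreducibility

Topic `Literature/AlgebraicGeometry/Resolution`; theorem-only; continuation of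
`Resolution/ExceptionalHostCharts`. For the exceptional host `E = X' ×_M B → B` over a sub-centre
`B ↪ V(𝓘)` of a regular-pair blowing up `β : X' → M` (Shioda–Katsura, Tôhoku Math. J. 31 (1979),
Thm. 1.7 (ii): "`Eⱼ → Bⱼ` is a `ℙ¹`-bundle"), the chart description
`Γ(E, j⁻¹X'[W, u]) ≅ Γ(B, i₀⁻¹W)[X]` gives:

* `flat_and_smoothOfRelativeDimension_one_of_polynomial_chart` — an affine open of `E` whose ring
  is a polynomial ring over that of an affine open of `B` (compatibly with `π^*`) is flat and smooth
  of relative dimension `1` over `B`;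
* `isPreirreducible_iUnion_of_forall_inter_nonempty` — a union of pairwise meeting preirreducible
  open sets is preirreducible (point-set lemma);
* `flat_snd_exceptionalHost`, `smoothOfRelativeDimension_one_snd_exceptionalHost`,
  `irreducibleSpace_exceptionalHost` — `π : E → B` is flat and smooth of relative dimension `1`,
  and `E` is irreducible when `B` is integral, provided the regular-pair charts cover `i₀(B)`.

## References

* T. Shioda, T. Katsura, On Fermat varieties, Tôhoku Math. J. 31 (1979) 97–115, §1 Thm. 1.7 (ii).
  [ShiodaKatsura1979]
* W. Fulton, *Intersection Theory* (1998), proof of Lemma 2.4 (p. 37), B.6.9. [Fulton1998]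
* R. Hartshorne, *Algebraic Geometry* (1977), III Prop. 10.1, III Ex. 10.0.1. [Hartshorne1977]
-/

noncomputable section

open CategoryTheory CategoryTheory.Limits AlgebraicGeometry TopologicalSpace Opposite Polynomial

universe u

namespace Literature.AlgebraicGeometry.Resolution

/-! ## Point-set lemma: unions of pairwise meeting irreducible opens -/

/-- **A union of preirreducible open subsets any two non-empty members of which meet is
preirreducible** (the usual "irreducibility is checked on a chained open cover").
[folklore] -/
theorem isPreirreducible_iUnion_of_forall_inter_nonempty {X : Type*} [TopologicalSpace X]
    {ι : Type*} {U : ι → Set X} (hUo : ∀ i, IsOpen (U i)) (hU : ∀ i, IsPreirreducible (U i))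
    (hpair : ∀ i i', (U i).Nonempty → (U i').Nonempty → (U i ∩ U i').Nonempty) :
    IsPreirreducible (⋃ i, U i) := by
  rintro O₁ O₂ hO₁ hO₂ ⟨x, hx, hx₁⟩ ⟨y, hy, hy₂⟩
  obtain ⟨i, hxi⟩ := Set.mem_iUnion.mp hx
  obtain ⟨i', hyi'⟩ := Set.mem_iUnion.mp hy
  obtain ⟨w, hwi, hwi'⟩ := hpair i i' ⟨x, hxi⟩ ⟨y, hyi'⟩
  -- in `U i`: `O₁` and `U i'` both meet it, hence meet each other inside it
  obtain ⟨w', hw'i, hw'₁, hw'i'⟩ := hU i O₁ (U i') hO₁ (hUo i') ⟨x, hxi, hx₁⟩ ⟨w, hwi, hwi'⟩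
  -- in `U i'`: `O₁` and `O₂` both meet it
  obtain ⟨t, hti', ht₁, ht₂⟩ := hU i' O₁ O₂ hO₁ hO₂ ⟨w', hw'i', hw'₁⟩ ⟨y, hyi', hy₂⟩
  exact ⟨t, Set.mem_iUnion.mpr ⟨i', hti'⟩, ht₁, ht₂⟩

/-- An affine open with integral coordinate ring is a preirreducible subset. [folklore] -/
theorem isPreirreducible_of_isAffineOpen_of_isDomain {X : Scheme.{u}} {P : X.Opens}
    (hP : IsAffineOpen P) [IsDomain Γ(X, P)] : IsPreirreducible (P : Set X) := by
  rw [← hP.range_fromSpec]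
  haveI : IrreducibleSpace (Spec Γ(X, P)) :=
    inferInstanceAs (IrreducibleSpace (PrimeSpectrum Γ(X, P)))
  simpa only [Set.image_univ] using
    ((IrreducibleSpace.isIrreducible_univ (Spec Γ(X, P))).image _
      hP.fromSpec.continuous.continuousOn).isPreirreducible

/-! ## Affine pieces with polynomial coordinate ring are flat and smooth of relative dimension 1 -/

/-- **An open piece of `E` with coordinate ring `Γ(B, V)[X]` over `Γ(B, V)` is flat and smooth of
relative dimension `1` over `B`** (`𝔸¹_V → V` is; Hartshorne III Ex. 10.0.1, Prop. 10.1).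
Precisely: `P ⊆ π⁻¹V` affine opens with `e : Γ(E, P) ≅ Γ(B, V)[X]`, `e ∘ π^* = C`; then
`P ↪ E → B` is `Spec Γ(B,V)[X] → Spec Γ(B,V) ↪ B` up to isomorphism.
[cite: Hartshorne1977, III §10 Example 10.0.1 and Prop. 10.1] -/
theorem flat_and_smoothOfRelativeDimension_one_of_polynomial_chart {E B : Scheme.{u}} (π : E ⟶ B)
    {P : E.Opens} (hP : IsAffineOpen P) {V : B.Opens} (hV : IsAffineOpen V) (hPV : P ≤ π ⁻¹ᵁ V)
    (e : Γ(E, P) ≃+* (Γ(B, V))[X]) (he : ∀ s, e (π.appLE V P hPV s) = C s) :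
    Flat (P.ι ≫ π) ∧ SmoothOfRelativeDimension 1 (P.ι ≫ π) := by
  -- `P ↪ E → B` factors as `P ≅ Spec Γ(P) → Spec Γ(V) → B`
  have hfac : P.ι ≫ π = hP.isoSpec.hom ≫ Spec.map (π.appLE V P hPV) ≫ hV.fromSpec := by
    rw [IsAffineOpen.SpecMap_appLE_fromSpec π hV hP hPV, ← Category.assoc,
      ← IsAffineOpen.isoSpec_inv_ι, Iso.hom_inv_id_assoc]
  -- the ring map `π^* : Γ(V) → Γ(P)` is `C` up to the isomorphism `e`
  have hring : (π.appLE V P hPV).hom = e.symm.toRingHom.comp C := by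
    ext s
    · change π.appLE V P hPV s = e.symm (C s)
      rw [← he, RingEquiv.symm_apply_apply]
  have hflat : (π.appLE V P hPV).hom.Flat := by
    rw [hring]
    refine RingHom.Flat.comp ?_ (RingHom.Flat.of_bijective e.symm.bijective)
    rw [← Polynomial.algebraMap_eq, RingHom.flat_algebraMap_iff]
    infer_instance
  have hsm : (π.appLE V P hPV).hom.IsStandardSmoothOfRelativeDimension 1 := by
    rw [hring]
    refine RingHom.isStandardSmoothOfRelativeDimension_respectsIso.1 _ e.symm ?_
    rw [← Polynomial.algebraMap_eq, RingHom.isStandardSmoothOfRelativeDimension_algebraMap]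
    have := Motives.ProjectiveSpace.isStandardSmoothOfRelativeDimension_mvPolynomial_fin
      Γ(B, V) 1
    exact Algebra.IsStandardSmoothOfRelativeDimension.of_algEquiv 1
      (MvPolynomial.uniqueAlgEquiv Γ(B, V) (Fin 1))
  haveI : Flat (Spec.map (π.appLE V P hPV)) :=
    (HasRingHomProperty.Spec_iff (P := @Flat)).mpr hflat
  haveI : SmoothOfRelativeDimension 1 (Spec.map (π.appLE V P hPV)) := by
    rw [HasRingHomProperty.Spec_iff (P := @SmoothOfRelativeDimension 1)]
    exact RingHom.locally_of RingHom.isStandardSmoothOfRelativeDimension_respectsIso _ hsm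
  rw [hfac]
  refine ⟨inferInstance, ?_⟩
  have h := smoothOfRelativeDimension_comp (n := 0) (m := 1 + 0) (f := hP.isoSpec.hom)
    (Spec.map (π.appLE V P hPV) ≫ hV.fromSpec)
  simpa using h

/-! ## The host `E = X' ×_M B → B` is flat, smooth of relative dimension `1`, irreducible -/

section Host

variable {M X' B : Scheme.{u}} {β : X' ⟶ M} {𝓘 : M.IdealSheafData} (i₀ : B ⟶ M)

/-- **`π : E → B` is flat and smooth of relative dimension `1`** when the regular-pair charts of
the blowing up cover `i₀(B)`: `E` is covered by the pieces `j⁻¹X'[W, u]`, `j⁻¹X'[W, v]`, each the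
affine line over `i₀⁻¹W` (`exists_ringEquiv_exceptional_piece`), and both properties are
Zariski-local on the source (Shioda–Katsura Thm. 1.7 (ii): `Eⱼ → Bⱼ` is a `ℙ¹`-bundle).
[cite: ShiodaKatsura1979, §1 Thm. 1.7 (ii)] [cite: Hartshorne1977, III Prop. 10.1] -/
theorem flat_and_smoothOfRelativeDimension_one_snd_exceptionalHost (hβ : IsBlowup β 𝓘)
    [IsClosedImmersion i₀] (hle : 𝓘 ≤ i₀.ker)
    (hcharts : ∀ y : B, ∃ (W : M.affineOpens) (u v : Γ(M, W)), i₀ y ∈ (W : M.Opens) ∧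
      𝓘.ideal W = Ideal.span {u, v} ∧ u ∈ nonZeroDivisors Γ(M, W) ∧
      (∀ r : Γ(M, W), u ∣ r * v → u ∣ r) ∧ v ∈ nonZeroDivisors Γ(M, W) ∧
      (∀ r : Γ(M, W), v ∣ r * u → v ∣ r)) :
    Flat (pullback.snd β i₀) ∧ SmoothOfRelativeDimension 1 (pullback.snd β i₀) := by
  choose W u v hyW hI hu huv hv hvu using hcharts
  have hI' : ∀ y, 𝓘.ideal (W y) = Ideal.span {v y, u y} := fun y ↦ by rw [hI, Set.pair_comm]
  -- the open cover of `E` by the chart pieces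
  let U : B × Bool → (pullback β i₀).Opens := fun p ↦
    pullback.fst β i₀ ⁻¹ᵁ blowupChart β 𝓘 (W p.1) (if p.2 then v p.1 else u p.1)
  have hU : iSup U = ⊤ := by
    refine top_le_iff.mp fun z _ ↦ ?_
    have hz : pullback.fst β i₀ z ∈ β ⁻¹ᵁ (W (pullback.snd β i₀ z) : M.Opens) := by
      change β (pullback.fst β i₀ z) ∈ (W (pullback.snd β i₀ z) : M.Opens)
      rw [← Scheme.Hom.comp_apply, pullback.condition, Scheme.Hom.comp_apply]
      exact hyW _
    rw [← hβ.blowupChart_sup_blowupChart_pair (W _) (hI _)] at hz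
    rcases hz with h | h
    · exact Opens.mem_iSup.mpr ⟨(pullback.snd β i₀ z, false), h⟩
    · exact Opens.mem_iSup.mpr ⟨(pullback.snd β i₀ z, true), h⟩
  -- each piece is an affine line over `i₀⁻¹ W`
  have hpiece : ∀ p : B × Bool, Flat ((U p).ι ≫ pullback.snd β i₀) ∧
      SmoothOfRelativeDimension 1 ((U p).ι ≫ pullback.snd β i₀) := by
    rintro ⟨y, b⟩
    have hVaff : IsAffineOpen (i₀ ⁻¹ᵁ (W y : M.Opens)) := (W y).2.preimage i₀
    cases b
    · obtain ⟨T, ε, -, hεC, -⟩ := exists_ringEquiv_exceptional_piece i₀ hβ hle (W y) (hI y)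
        (hu y) (huv y)
      have huI : u y ∈ 𝓘.ideal (W y) := (hI y) ▸ Ideal.subset_span (by simp)
      exact flat_and_smoothOfRelativeDimension_one_of_polynomial_chart (pullback.snd β i₀)
        ((hβ.isAffineOpen_blowupChart huI).preimage _) hVaff
        (preimage_fst_blowupChart_le i₀ (W y) (u y)) ε hεC
    · obtain ⟨T, ε, -, hεC, -⟩ := exists_ringEquiv_exceptional_piece i₀ hβ hle (W y) (hI' y)
        (hv y) (hvu y)
      have hvI : v y ∈ 𝓘.ideal (W y) := (hI y) ▸ Ideal.subset_span (by simp)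
      exact flat_and_smoothOfRelativeDimension_one_of_polynomial_chart (pullback.snd β i₀)
        ((hβ.isAffineOpen_blowupChart hvI).preimage _) hVaff
        (preimage_fst_blowupChart_le i₀ (W y) (v y)) ε hεC
  exact ⟨IsZariskiLocalAtSource.of_iSup_eq_top U hU fun p ↦ (hpiece p).1,
    IsZariskiLocalAtSource.of_iSup_eq_top U hU fun p ↦ (hpiece p).2⟩

/-- **The host `E` is irreducible** (for `B` integral, `E` reduced, and a section through the
lift of a ruling as in `exists_section_exceptional`): `E = ⋃_y (j⁻¹X'[W_y, u] ∪ j⁻¹X'[W_y, v])`,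
each piece the affine line over the integral `i₀⁻¹W_y`, the two pieces over `W_y` meeting along
`D(T)`, and the unions over `W_y`, `W_{y'}` meeting in `σ(i₀⁻¹(W_y ∩ W_{y'})) ≠ ∅`
(`isPreirreducible_iUnion_of_forall_inter_nonempty`). [cite: ShiodaKatsura1979, §1 Thm. 1.7 (ii)] -/
theorem irreducibleSpace_exceptionalHost (hβ : IsBlowup β 𝓘) [IsClosedImmersion i₀]
    [IsIntegral B] [IsReduced (pullback β i₀)] (hle : 𝓘 ≤ i₀.ker)
    {S : Scheme.{u}} {L : S ⟶ M} {q₀ : B ⟶ S} (hcart : IsEffectiveCartier (𝓘.comap L))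
    (hq : q₀ ≫ L = i₀) {σ : B ⟶ pullback β i₀} (hσ : σ ≫ pullback.fst β i₀ = q₀ ≫ hβ.lift L hcart)
    (hcharts : ∀ y : B, ∃ (W : M.affineOpens) (u v : Γ(M, W)), i₀ y ∈ (W : M.Opens) ∧
      𝓘.ideal W = Ideal.span {u, v} ∧ u ∈ nonZeroDivisors Γ(M, W) ∧
      (∀ r : Γ(M, W), u ∣ r * v → u ∣ r) ∧ v ∈ nonZeroDivisors Γ(M, W) ∧
      (∀ r : Γ(M, W), v ∣ r * u → v ∣ r)) :
    IrreducibleSpace ↑(pullback β i₀) := by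
  choose W u v hyW hI hu huv hv hvu using hcharts
  have hI' : ∀ y, 𝓘.ideal (W y) = Ideal.span {v y, u y} := fun y ↦ by rw [hI, Set.pair_comm]
  have huI : ∀ y, u y ∈ 𝓘.ideal (W y) := fun y ↦ (hI y) ▸ Ideal.subset_span (by simp)
  have hvI : ∀ y, v y ∈ 𝓘.ideal (W y) := fun y ↦ (hI y) ▸ Ideal.subset_span (by simp)
  -- `β (j (σ w)) = i₀ w`
  have hβσ : ∀ w, β (pullback.fst β i₀ (σ w)) = i₀ w := fun w ↦ by
    rw [← Scheme.Hom.comp_apply σ, hσ, ← Scheme.Hom.comp_apply, Category.assoc, hβ.lift_comp, hq]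
  -- the pieces
  let P : B → Bool → Set ↑(pullback β i₀) := fun y b ↦
    ((pullback.fst β i₀ ⁻¹ᵁ blowupChart β 𝓘 (W y) (if b then v y else u y) :
      (pullback β i₀).Opens) : Set ↑(pullback β i₀))
  have hPo : ∀ y b, IsOpen (P y b) := fun y b ↦ Opens.isOpen _
  -- each chart piece is preirreducible: empty, or an affine line over an integral affine
  have hPirr : ∀ y b, IsPreirreducible (P y b) := by
    intro y b
    rcases (P y b).eq_empty_or_nonempty with h | ⟨z, hz⟩
    · rw [h]; exact isPreirreducible_empty
    have hzW : pullback.snd β i₀ z ∈ i₀ ⁻¹ᵁ (W y : M.Opens) := by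
      cases b
      · exact preimage_fst_blowupChart_le i₀ (W y) (u y) hz
      · exact preimage_fst_blowupChart_le i₀ (W y) (v y) hz
    haveI : Nonempty (i₀ ⁻¹ᵁ (W y : M.Opens)) := ⟨⟨_, hzW⟩⟩
    haveI : IsDomain Γ(B, i₀ ⁻¹ᵁ (W y : M.Opens)) := IsIntegral.component_integral _
    cases b
    · change IsPreirreducible ((pullback.fst β i₀ ⁻¹ᵁ blowupChart β 𝓘 (W y) (u y) :
        (pullback β i₀).Opens) : Set ↑(pullback β i₀))
      obtain ⟨T, ε, -, -, -⟩ := exists_ringEquiv_exceptional_piece i₀ hβ hle (W y) (hI y)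
        (hu y) (huv y)
      haveI := MulEquiv.isDomain _ ε.toMulEquiv
      exact isPreirreducible_of_isAffineOpen_of_isDomain
        ((hβ.isAffineOpen_blowupChart (huI y)).preimage (pullback.fst β i₀))
    · change IsPreirreducible ((pullback.fst β i₀ ⁻¹ᵁ blowupChart β 𝓘 (W y) (v y) :
        (pullback β i₀).Opens) : Set ↑(pullback β i₀))
      obtain ⟨T, ε, -, -, -⟩ := exists_ringEquiv_exceptional_piece i₀ hβ hle (W y) (hI' y)
        (hv y) (hvu y)
      haveI := MulEquiv.isDomain _ ε.toMulEquiv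
      exact isPreirreducible_of_isAffineOpen_of_isDomain
        ((hβ.isAffineOpen_blowupChart (hvI y)).preimage (pullback.fst β i₀))
  -- the two pieces over `W y` meet along `D(T)`
  have hPy : ∀ y, IsPreirreducible (⋃ b, P y b) := by
    intro y
    refine isPreirreducible_iUnion_of_forall_inter_nonempty (hPo y) (hPirr y) fun b b' hb hb' ↦ ?_
    -- a point of `j⁻¹ D(T) ⊆ j⁻¹X'[W,u] ∩ j⁻¹X'[W,v]`
    obtain ⟨z, hz⟩ := hb
    have hzW : pullback.snd β i₀ z ∈ i₀ ⁻¹ᵁ (W y : M.Opens) := by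
      cases b
      · exact preimage_fst_blowupChart_le i₀ (W y) (u y) hz
      · exact preimage_fst_blowupChart_le i₀ (W y) (v y) hz
    haveI : Nonempty (i₀ ⁻¹ᵁ (W y : M.Opens)) := ⟨⟨_, hzW⟩⟩
    haveI : IsDomain Γ(B, i₀ ⁻¹ᵁ (W y : M.Opens)) := IsIntegral.component_integral _
    obtain ⟨T, ε, hT, -, hεX⟩ := exists_ringEquiv_exceptional_piece i₀ hβ hle (W y) (hI y)
      (hu y) (huv y)
    have hne : ((pullback β i₀).basicOpen ((pullback.fst β i₀).app _ T) :
        Set ↑(pullback β i₀)).Nonempty := by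
      rw [Set.nonempty_iff_ne_empty, Ne, ← Opens.coe_bot, SetLike.coe_set_eq,
        basicOpen_eq_bot_iff]
      intro h0
      have : (Polynomial.X : (Γ(B, i₀ ⁻¹ᵁ (W y : M.Opens)))[X]) = 0 := by rw [← hεX, h0, map_zero]
      exact Polynomial.X_ne_zero this
    obtain ⟨t, ht⟩ := hne
    have htD : pullback.fst β i₀ t ∈ X'.basicOpen T := by
      rw [← Scheme.preimage_basicOpen] at ht
      exact ht
    have htu : t ∈ P y false := X'.basicOpen_le T htD
    have htv : t ∈ P y true := hβ.basicOpen_le_blowupChart_pair (W y) (huI y) hT htD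
    cases b <;> cases b'
    · exact ⟨t, htu, htu⟩
    · exact ⟨t, htu, htv⟩
    · exact ⟨t, htv, htu⟩
    · exact ⟨t, htv, htv⟩
  -- `σ w` lies in both pieces-unions over `W y ∋ i₀ w`
  have hσP : ∀ y w, i₀ w ∈ (W y : M.Opens) → σ w ∈ ⋃ b, P y b := by
    intro y w hw
    have hz : pullback.fst β i₀ (σ w) ∈ β ⁻¹ᵁ (W y : M.Opens) := by
      change β (pullback.fst β i₀ (σ w)) ∈ (W y : M.Opens)
      rw [hβσ]
      exact hw
    rw [← hβ.blowupChart_sup_blowupChart_pair (W y) (hI y)] at hz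
    rcases hz with h | h
    · exact Set.mem_iUnion.mpr ⟨false, h⟩
    · exact Set.mem_iUnion.mpr ⟨true, h⟩
  have hcov : ⋃ y, ⋃ b, P y b = Set.univ := by
    refine Set.eq_univ_of_forall fun z ↦ Set.mem_iUnion.mpr ⟨pullback.snd β i₀ z, ?_⟩
    have hz : pullback.fst β i₀ z ∈ β ⁻¹ᵁ (W (pullback.snd β i₀ z) : M.Opens) := by
      change β (pullback.fst β i₀ z) ∈ (W (pullback.snd β i₀ z) : M.Opens)
      rw [← Scheme.Hom.comp_apply, pullback.condition, Scheme.Hom.comp_apply]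
      exact hyW _
    rw [← hβ.blowupChart_sup_blowupChart_pair (W _) (hI _)] at hz
    rcases hz with h | h
    · exact Set.mem_iUnion.mpr ⟨false, h⟩
    · exact Set.mem_iUnion.mpr ⟨true, h⟩
  have hall : IsPreirreducible (⋃ y, ⋃ b, P y b) := by
    refine isPreirreducible_iUnion_of_forall_inter_nonempty (fun y ↦ isOpen_iUnion (hPo y)) hPy
      fun y y' _ _ ↦ ?_
    -- `i₀⁻¹ W_y ∩ i₀⁻¹ W_{y'} ≠ ∅` in the irreducible `B`
    have hB := nonempty_preirreducible_inter (i₀ ⁻¹ᵁ (W y : M.Opens)).2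
      (i₀ ⁻¹ᵁ (W y' : M.Opens)).2 ⟨y, hyW y⟩ ⟨y', hyW y'⟩
    obtain ⟨w, hw, hw'⟩ := hB
    exact ⟨σ w, hσP y w hw, hσP y' w hw'⟩
  rw [hcov] at hall
  exact @IrreducibleSpace.mk _ _ ⟨hall⟩ ⟨σ (Classical.arbitrary B)⟩

end Host

/-! ## The host is a smooth projective variety -/

section Over

open Literature.AlgebraicGeometry.Motives

variable {k : Type u} [Field k] {M B X' : SchemeOver k} (β : X' ⟶ M) (i₀ : B ⟶ M)

/-- The closed immersion `j : E ↪ X'` as a `k`-morphism. [folklore] -/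
theorem fst_comp_hom_eq :
    pullback.fst β.left i₀.left ≫ X'.hom = pullback.snd β.left i₀.left ≫ B.hom := by
  rw [← Over.w β, pullback.condition_assoc, Over.w i₀]

/-- **The exceptional host is a smooth projective variety of dimension `dim B + 1`** over an
algebraically closed field: `E → B → Spec k` is smooth of relative dimension `1 + d`, `E ↪ X'`
is a closed immersion into a projective scheme, and `E` is integral (irreducible and, being
smooth, reduced), hence geometrically irreducible (Shioda–Katsura Thm. 1.7 (ii): the `ℙ¹`-bundles
`Eⱼ → Bⱼ ≅ Xʳₘ`). [cite: ShiodaKatsura1979, §1 Thm. 1.7 (ii)] [cite: Hartshorne1977, III Prop. 10.1 (c)] -/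
theorem isSmoothProjective_exceptionalHost [IsAlgClosed k] [IsClosedImmersion i₀.left] {d : ℕ}
    (hB : IsSmoothProjective d B) (hX' : IsProjectiveOver X')
    [SmoothOfRelativeDimension 1 (pullback.snd β.left i₀.left)]
    (hirr : IsReduced ↑(pullback β.left i₀.left) → IrreducibleSpace ↑(pullback β.left i₀.left)) :
    IsSmoothProjective (d + 1) (Over.mk (pullback.snd β.left i₀.left ≫ B.hom) : SchemeOver k) := by
  haveI := hB.smoothOfRelativeDimension
  have hsm : SmoothOfRelativeDimension (d + 1) (pullback.snd β.left i₀.left ≫ B.hom) := by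
    rw [add_comm]
    infer_instance
  -- projective: `E ↪ X' ↪ ℙⁿ`
  obtain ⟨n, ι, hι⟩ := hX'
  let jE : (Over.mk (pullback.snd β.left i₀.left ≫ B.hom) : SchemeOver k) ⟶ X' :=
    Over.homMk (pullback.fst β.left i₀.left) (fst_comp_hom_eq β i₀)
  have hproj : IsProjectiveOver (Over.mk (pullback.snd β.left i₀.left ≫ B.hom) : SchemeOver k) := by
    refine ⟨n, jE ≫ ι, ?_⟩
    rw [Over.comp_left]
    haveI : IsClosedImmersion jE.left :=
      inferInstanceAs (IsClosedImmersion (pullback.fst β.left i₀.left))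
    infer_instance
  -- geometrically irreducible: integral over an algebraically closed field
  haveI : Smooth (pullback.snd β.left i₀.left ≫ B.hom) :=
    SmoothOfRelativeDimension.smooth (n := d + 1) (f := pullback.snd β.left i₀.left ≫ B.hom)
  haveI : IsReduced ↑(pullback β.left i₀.left) :=
    isReduced_of_smooth_over_field (pullback.snd β.left i₀.left ≫ B.hom)
  haveI : IrreducibleSpace ↑(pullback β.left i₀.left) := hirr inferInstance
  haveI : IsIntegral ↑(pullback β.left i₀.left) := isIntegral_of_irreducibleSpace_of_isReduced _
  haveI := geometricallyIntegral_of_isAlgClosed (pullback.snd β.left i₀.left ≫ B.hom)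
  have hgi : GeometricallyIrreducible (pullback.snd β.left i₀.left ≫ B.hom) := inferInstance
  exact ⟨hsm, hproj, hgi⟩

end Over

end Literature.AlgebraicGeometry.Resolution

end
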